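import Mathlib
import HarnessLib
import Literature.Analysis.FluidPDE.ClassicalSolution
import Literature.Analysis.FluidPDE.Vorticity
import Summits.NavierStokesRegularity.NavierStokesRegularity.Theorems.QuarterLogPincerBeadCensusDefs
import Summits.NavierStokesRegularity.NavierStokesRegularity.Theorems.QuarterLogPincerBeadCensusKernel
import Summits.NavierStokesRegularity.NavierStokesRegularity.Theorems.QuarterLogPincerCubicRungDefs
import Summits.NavierStokesRegularity.NavierStokesRegularity.Theorems.QuarterLogPincerThinCascadeDefs
import Summits.NavierStokesRegularity.NavierStokesRegularity.Theorems.QuarterLogPincerTypeIQuantSubcubicExpStubUniformScaledEnergy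
import Summits.NavierStokesRegularity.NavierStokesRegularity.Theorems.QuarterLogPincerTypeIQuantSubcubicExpFrameTools
import Summits.NavierStokesRegularity.NavierStokesRegularity.Theorems.QuarterLogPincerTypeIQuantSubcubicExpZoomEnergyA
import Summits.NavierStokesRegularity.NavierStokesRegularity.Theorems.QuarterLogPincerTypeIQuantSubcubicExpRescaleTools
import Summits.NavierStokesRegularity.NavierStokesRegularity.Theorems.QuarterLogPincerTypeIQuantSubcubicExpUnitScaleTools
import Summits.NavierStokesRegularity.NavierStokesRegularity.Theorems.QuarterLogPincerHelmholtzCentreDefs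
import Summits.NavierStokesRegularity.NavierStokesRegularity.Theorems.QuarterLogPincerHelmholtzCentreShellKernel
import Summits.NavierStokesRegularity.NavierStokesRegularity.Theorems.QuarterLogPincerFlatChainDefs
import Summits.NavierStokesRegularity.NavierStokesRegularity.Theorems.QuarterLogPincerFlatChainTypeIEpoch
import Literature.Analysis.FluidPDE.BarkerPrangeLocalizedSmoothingBounds
import Literature.Analysis.FluidPDE.BarkerPrangeConcentrationProofs
import Literature.Analysis.FluidPDE.BackwardHeatPointwise
import Literature.Analysis.FluidPDE.AncientWeakL3BackwardLiouvilleAssembly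
import Literature.Analysis.FluidPDE.LocalEnergySolutionsOn
import Literature.Analysis.FluidPDE.LocalLerayExistence
import Literature.Analysis.FluidPDE.BoundedMildWeakL3LocalEnergySolution
import Literature.Analysis.FluidPDE.BoundedMildWeakL3RieszPressure
import Literature.Analysis.FluidPDE.KatoLocalLerayPressureProofs
import Literature.Analysis.FluidPDE.VeryWeakToDistributional
import Literature.Analysis.FluidPDE.VeryWeakToDistributionalFour
import Literature.Analysis.FluidPDE.ClassicalBoundedWeak
import Literature.Analysis.FluidPDE.MildSolution
import Literature.Analysis.SingularIntegrals.HardyLittlewoodSobolev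
import Literature.Analysis.FluidPDE.VorticityCalculus
import Literature.Analysis.FluidPDE.BiotSavartWeakLp
import Summits.NavierStokesRegularity.NavierStokesRegularity.Theorems.QuarterLogPincerFlatChainSliceDefs
import Summits.NavierStokesRegularity.NavierStokesRegularity.Theorems.QuarterLogPincerFlatChainQuietSlice
import Summits.NavierStokesRegularity.NavierStokesRegularity.Theorems.QuarterLogPincerFlatChainSlicePressure
import Summits.NavierStokesRegularity.NavierStokesRegularity.Theorems.QuarterLogPincerFlatChainLevelConcentrationTools

/-!
# Route `QuarterLogPincer`, crux `TypeIQuantSubcubicExp` (stmt-NavierStokesRegularity-24077), line `flat_chain` —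
# ★ S1: `levelConcentration_of_slice_holds : LocalEnergySlice → QuietSliceSmallCube → LevelConcentration` (Q4|P, the author's §11 proof
# VERBATIM) and `levelConcentration_of_stubs : LevelConcentration` UNCONDITIONAL (P, Q3 PROVED)

HONEST FRAME: ports of the author's kernel-checked in-file proofs about HYPOTHETICAL Type-I classical solutions; no census node,
⟨24077⟩, W7 or Navier–Stokes regularity is proved (OPEN).  pub-ns-dss typer (g39), `--supports stmt-NavierStokesRegularity-24077`;
texts by ns-idea-7 (g14), workfile `Cruxes/TypeIQuantSubcubicExp/Lines/flat_chain.lean` v1.12 (sha f4adcfe506ba), VERBATIM.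
-/

set_option linter.dupNamespace false

namespace Summit.NavierStokesRegularity.NavierStokesRegularity.Cruxes.TypeIQuantSubcubicExp.FlatChain

noncomputable section

open MeasureTheory Set Metric
open scoped ENNReal NNReal Classical
open Literature.Analysis Literature.Analysis.FluidPDE
open Summit.NavierStokesRegularity.NavierStokesRegularity.Cruxes.TypeIQuantSubcubicExp.BeadCensus
open Summit.NavierStokesRegularity.NavierStokesRegularity.Cruxes.TypeIQuantSubcubicExp.CubicRung

section Q4Proof

open Summit.NavierStokesRegularity.NavierStokesRegularity.Cruxes.TypeIQuantSubcubicExp.ThinCascade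
  (TaoFrame UniformScaledEnergy stub_uniformScaledEnergy)
open Summit.NavierStokesRegularity.NavierStokesRegularity.Theorems.ThinCascade
  (frame_restrict typeI_restrict)
open Filter Topology

/-- **Q4|P (PROVED, v1.12).** `LocalEnergySlice → QuietSliceSmallCube → LevelConcentration` — see the §11 docblock. -/
theorem levelConcentration_of_slice_holds : LocalEnergySlice → QuietSliceSmallCube → LevelConcentration := by
  intro hP hQ M
  -- ## constants depending on `M` only
  obtain ⟨Mt, hMt, HP⟩ := hP M
  obtain ⟨CQ, hCQ, HQ⟩ := hQ
  obtain ⟨CI, HI⟩ := stub_uniformScaledEnergy M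
  obtain ⟨γ, hγ, HBP⟩ := BarkerPrange2020_thm1_slab_bounds
  obtain ⟨S, hS, hS4, HS⟩ := HBP Mt hMt
  obtain ⟨Cb, C₁, hCb, -, HB⟩ := HS (S / 2) ⟨by linarith, by linarith⟩
  have hS1 : S ≤ 1 := hS4.trans (by norm_num)
  have hsqS : 0 < Real.sqrt S := Real.sqrt_pos.2 hS
  have hsqS2 : Real.sqrt S ^ 2 = S := Real.sq_sqrt hS.le
  set Cp : ℝ := max CI 0 with hCp
  have hCp0 : 0 ≤ Cp := le_max_right _ _
  set B : ℝ := volume.real (ball (0 : EuclideanSpace ℝ (Fin 3)) 1) with hBdef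
  have hB : 0 < B := by
    rw [hBdef, measureReal_def]
    exact ENNReal.toReal_pos (measure_ball_pos volume _ one_pos).ne' measure_ball_lt_top.ne
  set g : ℝ := γ ^ 3 / (3 * CQ) with hgdef
  have hg0 : 0 < g := by positivity
  have h3g : CQ * (3 * g) = γ ^ 3 := by rw [hgdef]; field_simp
  set K₂ : ℝ := (16 * Real.sqrt (B * Cp) / Real.sqrt S) ^ 3 with hK₂
  set ρ : ℝ := max (max 1 (8 / Real.sqrt S)) (K₂ / g) with hρdef
  have hρ1 : 1 ≤ ρ := (le_max_left _ _).trans (le_max_left _ _)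
  have hρ0 : 0 < ρ := lt_of_lt_of_le one_pos hρ1
  have hρ8 : 8 / Real.sqrt S ≤ ρ := (le_max_right _ _).trans (le_max_left _ _)
  have hρK : K₂ / g ≤ ρ := le_max_right _ _
  have hρ64 : 64 / S ≤ ρ ^ 2 := by
    have h : (8 / Real.sqrt S) ^ 2 = 64 / S := by rw [div_pow, hsqS2]; norm_num
    rw [← h]
    exact pow_le_pow_left₀ (by positivity) hρ8 2
  set m : ℝ := min 1 g with hmdef
  have hm0 : 0 < m := lt_min one_pos hg0
  set η : ℝ := min (Real.sqrt S / 2 * m) (S * ρ * m ^ 2 / (64 * B)) with hηdef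
  have hη0 : 0 < η := lt_min (by positivity) (by positivity)
  have hη1 : η ≤ Real.sqrt S / 2 * m := min_le_left _ _
  have hη2 : η ≤ S * ρ * m ^ 2 / (64 * B) := min_le_right _ _
  refine ⟨ρ, η, hρ0, hη0, fun D hD => ?_⟩
  -- ## the threshold `a₁(M, D)`
  have hD0 : 0 < D := lt_of_lt_of_le (by norm_num) hD
  have hpS : 0 ≤ 1 / S := by positivity
  have hpC : 0 ≤ Cb * Real.sqrt (S * D) := by positivity
  have hpρ : 0 ≤ ρ ^ 2 := by positivity
  refine ⟨ρ ^ 2 + 1 / S + Cb * Real.sqrt (S * D) + 1, by positivity, fun a ha => ?_⟩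
  have ha0 : 0 ≤ a := by linarith only [ha, hpS, hpC, hpρ]
  have haρ : ρ ^ 2 ≤ a := by linarith only [ha, hpS, hpC]
  have haS : 1 / S ≤ a := by linarith only [ha, hpρ, hpC]
  have haC : Cb * Real.sqrt (S * D) + 1 ≤ a := by linarith only [ha, hpS, hpρ]
  have hexp2a : 2 * a + 1 ≤ Real.exp (2 * a) := Real.add_one_le_exp (2 * a)
  -- `ρ² e^{-2a} ≤ 8` and `e^{-2a} ≤ 2S`
  have he2aρ : ρ ^ 2 * Real.exp (-(2 * a)) ≤ 8 := by
    have h1 : Real.exp (-(2 * a)) ≤ 8 / ρ ^ 2 := by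
      refine q4_exp_neg_le ?_
      rw [div_mul_eq_mul_div, le_div_iff₀ (by positivity)]
      linarith only [hexp2a, haρ, hpρ]
    calc ρ ^ 2 * Real.exp (-(2 * a)) ≤ ρ ^ 2 * (8 / ρ ^ 2) := mul_le_mul_of_nonneg_left h1 hpρ
      _ = 8 := by field_simp
  have he2aS : Real.exp (-(2 * a)) ≤ 2 * S := by
    refine q4_exp_neg_le ?_
    have h1 : 1 ≤ a * S := by rw [div_le_iff₀ hS] at haS; exact haS
    have h2 := mul_le_mul_of_nonneg_left hexp2a (by positivity : (0 : ℝ) ≤ 2 * S)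
    linarith only [h1, h2, hS.le]
  have he2a1 : Real.exp (-(2 * a)) ≤ 1 := Real.exp_le_one_iff.2 (by linarith only [ha0])
  intro T τ t₁ x₀ u p n hfr hτ hrate ht₁ hviol k hk t ht
  by_contra hlt
  rw [not_le] at hlt
  -- ## the scales of level `k+1`
  have ht₁0 : 0 < t₁ := ht₁.1
  have ht₁T : t₁ ≤ T := ht₁.2
  have hk1 : (1 : ℝ) ≤ ((k + 1 : ℕ) : ℝ) := by exact_mod_cast Nat.le_add_left 1 k
  have hkn : ((k + 1 : ℕ) : ℝ) ≤ (n : ℝ) := by exact_mod_cast Nat.succ_le_of_lt hk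
  obtain ⟨E, hEdef⟩ : ∃ E : ℝ, Real.exp (-2 * a * ((k + 1 : ℕ) : ℝ)) = E := ⟨_, rfl⟩
  have hE0 : 0 < E := by rw [← hEdef]; exact Real.exp_pos _
  have hEa : E ≤ Real.exp (-(2 * a)) := by
    rw [← hEdef]
    refine Real.exp_le_exp.2 ?_
    have h := mul_le_mul_of_nonneg_left hk1 (by linarith only [ha0] : (0 : ℝ) ≤ 2 * a)
    linarith only [h]
  -- `σ = s_{k+1}/D`, `q = √σ`
  obtain ⟨σ, hσdef⟩ : ∃ σ : ℝ, levelScale a t₁ (k + 1) / D = σ := ⟨_, rfl⟩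
  rw [hσdef] at ht hlt
  have hσE : σ = t₁ * E / D := by rw [← hσdef, ← hEdef]; rfl
  have hσ0 : 0 < σ := by rw [hσE]; positivity
  have hσle : σ ≤ t₁ * Real.exp (-(2 * a)) / 8 := by
    calc σ = t₁ * E / D := hσE
      _ ≤ t₁ * Real.exp (-(2 * a)) / D := by gcongr
      _ ≤ t₁ * Real.exp (-(2 * a)) / 8 := by gcongr
  have h4σ : 4 * σ ≤ t₁ / 2 := by
    have : t₁ * Real.exp (-(2 * a)) ≤ t₁ * 1 := mul_le_mul_of_nonneg_left he2a1 ht₁0.le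
    linarith only [hσle, this]
  have ht0 : 0 ≤ t := by linarith only [ht.1, h4σ, ht₁0]
  have htT : t ≤ T := by linarith only [ht.2, hσ0, ht₁T]
  have htI : t ∈ Icc 0 T := ⟨ht0, htT⟩
  obtain ⟨d, hddef⟩ : ∃ d : ℝ, t₁ - t = d := ⟨_, rfl⟩
  have hdσ : σ ≤ d := by rw [← hddef]; linarith only [ht.2]
  have hd4 : d ≤ 4 * σ := by rw [← hddef]; linarith only [ht.1]
  have hd0 : 0 < d := lt_of_lt_of_le hσ0 hdσ
  obtain ⟨q, hqdef⟩ : ∃ q : ℝ, Real.sqrt σ = q := ⟨_, rfl⟩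
  rw [hqdef] at hlt
  have hq0 : 0 < q := by rw [← hqdef]; exact Real.sqrt_pos.2 hσ0
  have hq2 : q ^ 2 = σ := by rw [← hqdef]; exact Real.sq_sqrt hσ0.le
  -- the smoothing radius `r`, `r² = (t₁ - t)/S ∈ [σ/S, 4σ/S]`
  obtain ⟨r, hrdef⟩ : ∃ r : ℝ, Real.sqrt (d / S) = r := ⟨_, rfl⟩
  have hr0 : 0 < r := by rw [← hrdef]; exact Real.sqrt_pos.2 (by positivity)
  have hr2 : r ^ 2 = d / S := by rw [← hrdef]; exact Real.sq_sqrt (by positivity)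
  have hr2le : r ^ 2 ≤ 4 * q ^ 2 / S := by rw [hr2, hq2]; gcongr
  have hSr : S * r ^ 2 = d := by rw [hr2]; field_simp
  have hwin : t + S * r ^ 2 ≤ T := by rw [hSr, ← hddef]; linarith only [ht₁T]
  have htS : t + r ^ 2 * S = t₁ := by rw [mul_comm, hSr, ← hddef]; ring
  have hr2T : r ^ 2 ≤ T := by
    calc r ^ 2 ≤ 4 * q ^ 2 / S := hr2le
      _ = 4 * σ / S := by rw [hq2]
      _ ≤ 4 * (t₁ * Real.exp (-(2 * a)) / 8) / S := by gcongr
      _ = t₁ * Real.exp (-(2 * a)) / (2 * S) := by ring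
      _ ≤ t₁ * (2 * S) / (2 * S) := by gcongr
      _ = t₁ := by field_simp
      _ ≤ T := ht₁T
  -- the quiet radius `2R = ρ q`
  obtain ⟨R, hRdef⟩ : ∃ R : ℝ, R = ρ * q / 2 := ⟨_, rfl⟩
  have hR0 : 0 < R := by rw [hRdef]; positivity
  have h2R : 2 * R = ρ * q := by rw [hRdef]; ring
  have hρq0 : 0 < ρ * q := by positivity
  have h2rR : 2 * r ≤ R := by
    have hsq : (2 * r) ^ 2 ≤ R ^ 2 := by
      calc (2 * r) ^ 2 = 4 * r ^ 2 := by ring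
        _ ≤ 4 * (4 * q ^ 2 / S) := by gcongr
        _ = (64 / S) * q ^ 2 / 4 := by ring
        _ ≤ ρ ^ 2 * q ^ 2 / 4 := by gcongr
        _ = R ^ 2 := by rw [hRdef]; ring
    exact (pow_le_pow_iff_left₀ (by positivity) hR0.le two_ne_zero).1 hsq
  have hRT : (ρ * q) ^ 2 ≤ T := by
    calc (ρ * q) ^ 2 = ρ ^ 2 * σ := by rw [mul_pow, hq2]
      _ ≤ ρ ^ 2 * (t₁ * Real.exp (-(2 * a)) / 8) := by gcongr
      _ = t₁ * (ρ ^ 2 * Real.exp (-(2 * a))) / 8 := by ring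
      _ ≤ t₁ * 8 / 8 := by gcongr
      _ = t₁ := by ring
      _ ≤ T := ht₁T
  -- ## P: the rescaled slice is a local energy solution with `E²` datum and uloc bound `Mt`
  obtain ⟨π, hles, hE2, huloc⟩ := HP T τ u p hfr hτ hrate x₀ t r S hr0 hS hS1 ht0 hr2T hwin
  -- ## the slice `u(t)` is smooth and divergence-free
  have hCinf := hfr.1.contDiff_velocity htI
  have hC2 : ContDiff ℝ 2 (u t) := contDiff_infty.1 hCinf 2
  have hC1 : ContDiff ℝ 1 (u t) := contDiff_infty.1 hCinf 1
  have hcu : Continuous (u t) := hCinf.continuous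
  have hcω : Continuous (curl (u t)) := continuous_curl hC1
  have hdiv : VectorCalculus.IsDivFree (u t) := hfr.1.divFree t htI
  -- ## Q3 at the slice
  have hQ3 := HQ (u t) hC2 hdiv x₀ r R hr0 h2rR
  rw [h2R] at hQ3
  obtain ⟨W, hWdef⟩ : ∃ W : ℝ, (∫ y in ball x₀ (ρ * q), ‖curl (u t) y‖ ^ 2) = W := ⟨_, rfl⟩
  obtain ⟨Iu, hIudef⟩ : ∃ Iu : ℝ, (∫ y in ball x₀ (ρ * q), ‖u t y‖) = Iu := ⟨_, rfl⟩
  obtain ⟨Iω, hIωdef⟩ : ∃ Iω : ℝ, (∫ y in ball x₀ (ρ * q), ‖curl (u t) y‖) = Iω := ⟨_, rfl⟩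
  rw [hWdef, hIudef, hIωdef] at hQ3
  have hW0 : 0 ≤ W := by rw [← hWdef]; exact integral_nonneg fun y => sq_nonneg _
  have hIu0 : 0 ≤ Iu := by rw [← hIudef]; exact integral_nonneg fun y => norm_nonneg _
  have hIω0 : 0 ≤ Iω := by rw [← hIωdef]; exact integral_nonneg fun y => norm_nonneg _
  -- the quiet hypothesis `W < η σ^{-1/2} = η/q`
  have hWle : W ≤ η / q := by
    have h1 : η * σ ^ (-(1 / 2 : ℝ)) = η / q := by
      rw [Real.rpow_neg hσ0.le, ← Real.sqrt_eq_rpow, hqdef, div_eq_mul_inv]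
    have h2 : W < η * σ ^ (-(1 / 2 : ℝ)) := by rw [← hWdef]; simpa only [vorticity_apply] using hlt
    rw [h1] at h2
    exact h2.le
  -- I1 at `(t, x₀)`, radius `ρ q`
  have hI1 : ∫ y in ball x₀ (ρ * q), ‖u t y‖ ^ 2 ≤ Cp * (ρ * q) :=
    q4_I1_integral_at HI hfr hτ hrate x₀ hρq0 ht0 htT hRT
  -- Cauchy–Schwarz on `B(x₀, ρ q)`
  have hvol : volume.real (ball x₀ (ρ * q)) = (ρ * q) ^ 3 * B := volume_real_ball_eq x₀ hρq0
  have hIu2 : Iu ^ 2 ≤ B * (2 * R) ^ 3 * (Cp * (2 * R)) := by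
    have h := q4_integral_norm_le_sqrt hcu x₀ (ρ * q)
    rw [hIudef] at h
    have hX0 : 0 ≤ volume.real (ball x₀ (ρ * q)) * ∫ y in ball x₀ (ρ * q), ‖u t y‖ ^ 2 :=
      mul_nonneg measureReal_nonneg (integral_nonneg fun _ => sq_nonneg _)
    calc Iu ^ 2 ≤ (Real.sqrt (volume.real (ball x₀ (ρ * q)) * ∫ y in ball x₀ (ρ * q), ‖u t y‖ ^ 2)) ^ 2 :=
          pow_le_pow_left₀ hIu0 h 2
      _ = volume.real (ball x₀ (ρ * q)) * ∫ y in ball x₀ (ρ * q), ‖u t y‖ ^ 2 := Real.sq_sqrt hX0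
      _ ≤ (ρ * q) ^ 3 * B * (Cp * (ρ * q)) := by rw [hvol]; gcongr
      _ = B * (2 * R) ^ 3 * (Cp * (2 * R)) := by rw [h2R]; ring
  have hIω2 : Iω ^ 2 ≤ B * (2 * R) ^ 3 * W := by
    have h := q4_integral_norm_le_sqrt hcω x₀ (ρ * q)
    rw [hWdef, hIωdef] at h
    have hX0 : 0 ≤ volume.real (ball x₀ (ρ * q)) * W := mul_nonneg measureReal_nonneg hW0
    calc Iω ^ 2 ≤ (Real.sqrt (volume.real (ball x₀ (ρ * q)) * W)) ^ 2 := pow_le_pow_left₀ hIω0 h 2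
      _ = volume.real (ball x₀ (ρ * q)) * W := Real.sq_sqrt hX0
      _ = B * (2 * R) ^ 3 * W := by rw [hvol, h2R]; ring
  -- ## the arithmetic: the three Q3 terms are `≤ g = γ³/(3 C_Q)` each
  have harith := q4_arith hB hCp0 hS hq0 hr0 hW0 hIu0 hIω0 hg0 hρ1 hρK hη1 hη2 hRdef hr2le hWle hIu2 hIω2
  have hcube : ∫⁻ y in ball x₀ (2 * r), ‖u t y‖ₑ ^ (3 : ℝ) ≤ ENNReal.ofReal (γ ^ 3) := by
    refine hQ3.trans (ENNReal.ofReal_le_ofReal ?_)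
    rw [← h3g]
    exact mul_le_mul_of_nonneg_left harith hCQ.le
  have hcube' : ∫⁻ y in ball x₀ (2 * r), ‖u t y‖ₑ ^ 3 ≤ ENNReal.ofReal (γ ^ 3) := by
    have e : ∫⁻ y in ball x₀ (2 * r), ‖u t y‖ₑ ^ (3 : ℝ) = ∫⁻ y in ball x₀ (2 * r), ‖u t y‖ₑ ^ 3 :=
      lintegral_congr fun y => by rw [show (3 : ℝ) = ((3 : ℕ) : ℝ) by norm_num, ENNReal.rpow_natCast]
    rw [← e]; exact hcube
  have hL3u : eLpNorm (u t) 3 (volume.restrict (ball x₀ (2 * r))) ≤ ENNReal.ofReal γ := by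
    -- `∫ ‖f‖³ ≤ γ³ ⇒ ‖f‖₃ ≤ γ` (= the tree's `EnstrophyQuarterLaw.SparseSieve.eLpNorm_three_le_of_lintegral_cube_le`, inlined)
    rw [eLpNorm_eq_lintegral_rpow_enorm_toReal three_ne_zero ENNReal.ofNat_ne_top, ENNReal.toReal_ofNat]
    have e3 : ∫⁻ y in ball x₀ (2 * r), ‖u t y‖ₑ ^ (3 : ℝ) = ∫⁻ y in ball x₀ (2 * r), ‖u t y‖ₑ ^ 3 :=
      lintegral_congr fun y => by rw [show (3 : ℝ) = ((3 : ℕ) : ℝ) by norm_num, ENNReal.rpow_natCast]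
    rw [e3]
    calc (∫⁻ y in ball x₀ (2 * r), ‖u t y‖ₑ ^ 3) ^ (1 / (3 : ℝ)) ≤ (ENNReal.ofReal (γ ^ 3)) ^ (1 / (3 : ℝ)) :=
          ENNReal.rpow_le_rpow hcube' (by norm_num)
      _ = ENNReal.ofReal ((γ ^ 3) ^ (1 / (3 : ℝ))) := ENNReal.ofReal_rpow_of_nonneg (by positivity) (by norm_num)
      _ = ENNReal.ofReal γ := by
          rw [← Real.rpow_natCast γ 3, ← Real.rpow_mul hγ.le]; norm_num
  -- ## transport to the rescaled datum: `‖v(0)‖_{L³(B(0,2))} ≤ γ`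
  have hv0 : sliceField u x₀ t r 0 = fun y => r • u t (x₀ + r • y) := by
    funext y; rw [sliceField_apply, mul_zero, add_zero]
  have hsmul : ∀ (q' : ℝ≥0∞) (μ : Measure (EuclideanSpace ℝ (Fin 3))),
      eLpNorm (fun y => r • u t (x₀ + r • y)) q' μ = ‖r‖ₑ * eLpNorm (fun y => u t (x₀ + r • y)) q' μ :=
    fun q' μ => by
      rw [show (fun y => r • u t (x₀ + r • y)) = r • fun y => u t (x₀ + r • y) from rfl, eLpNorm_const_smul]
  have hlr : ‖r‖ₑ = ENNReal.ofReal r := Real.enorm_eq_ofReal hr0.le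
  have hL3' : eLpNorm (sliceField u x₀ t r 0) 3 (volume.restrict (ball (0 : EuclideanSpace ℝ (Fin 3)) 2)) ≤
      ENNReal.ofReal γ := by
    rw [hv0]
    calc eLpNorm (fun y => r • u t (x₀ + r • y)) 3 (volume.restrict (ball (0 : EuclideanSpace ℝ (Fin 3)) 2))
        = ‖r‖ₑ * (ENNReal.ofReal ((r ^ 3)⁻¹) ^ (1 / (3 : ℝ≥0∞)).toReal *
            eLpNorm (u t) 3 (volume.restrict (ball (x₀ + r • (0 : EuclideanSpace ℝ (Fin 3))) (r * 2)))) := by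
          rw [hsmul, eLpNorm_comp_add_smul_ball (u t) x₀ 0 hr0 2 (by norm_num)]
      _ ≤ ‖r‖ₑ * (ENNReal.ofReal r⁻¹ * ENNReal.ofReal γ) := by
          rw [ofReal_inv_cube_rpow_third hr0, smul_zero, add_zero, mul_comm r 2]
          gcongr
      _ = ENNReal.ofReal γ := by
          rw [hlr, ← ENNReal.ofReal_mul (by positivity), ← ENNReal.ofReal_mul (by positivity)]
          congr 1
          field_simp
  -- ## Barker–Prange (i): `‖v‖ ≤ Cb` a.e. on `(S/2,S) × B(0,1/3)`, hence everywhere there, hence at `(S,0)`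
  obtain ⟨hae, -, -⟩ := HB _ _ π hles hE2 huloc hL3'
  have hcontv := sliceField_continuousOn hfr.1 x₀ hr0 hS ht0 hwin
  set U : Set (ℝ × EuclideanSpace ℝ (Fin 3)) := Ioo (S / 2) S ×ˢ ball (0 : EuclideanSpace ℝ (Fin 3)) (1 / 3) with hU
  have hUsub : U ⊆ Icc 0 S ×ˢ (univ : Set (EuclideanSpace ℝ (Fin 3))) :=
    prod_mono (fun s' hs' => ⟨by linarith [hs'.1], hs'.2.le⟩) (subset_univ _)
  have hae' : ∀ᵐ z ∂(volume.restrict U), ‖Function.uncurry (sliceField u x₀ t r) z‖ ≤ Cb :=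
    hae.mono fun w hw => hw
  have hall := norm_le_of_ae_le_of_continuousOn (isOpen_Ioo.prod isOpen_ball) (hcontv.mono hUsub) hae'
  have hend : ‖sliceField u x₀ t r S 0‖ ≤ Cb := q4_norm_endpoint_le hS hcontv hall
  have hvS : sliceField u x₀ t r S 0 = r • u t₁ x₀ := by
    rw [sliceField_apply, smul_zero, add_zero, htS]
  rw [hvS, norm_smul, Real.norm_of_nonneg hr0.le] at hend
  -- ## the contradiction with the violator `e^{a(n+1)} ≤ ‖u(t₁,x₀)‖ √t₁`
  have hEe : E * Real.exp (a * ((k + 1 : ℕ) : ℝ)) ^ 2 = 1 := by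
    rw [← hEdef, sq, ← Real.exp_add, ← Real.exp_add, ← Real.exp_zero]
    congr 1; ring
  have hσD : σ * D = t₁ * E := by rw [hσE]; field_simp
  have ht₁eq : t₁ = σ * D * Real.exp (a * ((k + 1 : ℕ) : ℝ)) ^ 2 := by
    rw [hσD]
    calc t₁ = t₁ * (E * Real.exp (a * ((k + 1 : ℕ) : ℝ)) ^ 2) := by rw [hEe, mul_one]
      _ = t₁ * E * Real.exp (a * ((k + 1 : ℕ) : ℝ)) ^ 2 := by ring
  have hkey : Real.sqrt t₁ ≤ r * (Real.sqrt (S * D) * Real.exp (a * ((k + 1 : ℕ) : ℝ))) := by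
    have h0 : 0 ≤ r * (Real.sqrt (S * D) * Real.exp (a * ((k + 1 : ℕ) : ℝ))) := by positivity
    have hsq : Real.sqrt t₁ ^ 2 ≤ (r * (Real.sqrt (S * D) * Real.exp (a * ((k + 1 : ℕ) : ℝ)))) ^ 2 := by
      calc Real.sqrt t₁ ^ 2 = t₁ := Real.sq_sqrt ht₁0.le
        _ = σ * D * Real.exp (a * ((k + 1 : ℕ) : ℝ)) ^ 2 := ht₁eq
        _ ≤ d * D * Real.exp (a * ((k + 1 : ℕ) : ℝ)) ^ 2 := by gcongr
        _ = (r * (Real.sqrt (S * D) * Real.exp (a * ((k + 1 : ℕ) : ℝ)))) ^ 2 := by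
            rw [mul_pow, mul_pow, Real.sq_sqrt (by positivity), hr2]; field_simp
    exact (pow_le_pow_iff_left₀ (Real.sqrt_nonneg _) h0 two_ne_zero).1 hsq
  have hexpkn : Real.exp (a * ((k + 1 : ℕ) : ℝ)) ≤ Real.exp (a * n) :=
    Real.exp_le_exp.2 (mul_le_mul_of_nonneg_left hkn ha0)
  have hCe : Cb * Real.sqrt (S * D) < Real.exp a := by linarith only [Real.add_one_le_exp a, haC]
  have hchain : ‖u t₁ x₀‖ * Real.sqrt t₁ < Real.exp (a * (n + 1)) := by
    calc ‖u t₁ x₀‖ * Real.sqrt t₁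
        ≤ ‖u t₁ x₀‖ * (r * (Real.sqrt (S * D) * Real.exp (a * ((k + 1 : ℕ) : ℝ)))) :=
          mul_le_mul_of_nonneg_left hkey (norm_nonneg _)
      _ = (r * ‖u t₁ x₀‖) * (Real.sqrt (S * D) * Real.exp (a * ((k + 1 : ℕ) : ℝ))) := by ring
      _ ≤ Cb * (Real.sqrt (S * D) * Real.exp (a * ((k + 1 : ℕ) : ℝ))) :=
          mul_le_mul_of_nonneg_right hend (by positivity)
      _ ≤ Cb * (Real.sqrt (S * D) * Real.exp (a * n)) := by gcongr
      _ = (Cb * Real.sqrt (S * D)) * Real.exp (a * n) := by ring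
      _ < Real.exp a * Real.exp (a * n) := mul_lt_mul_of_pos_right hCe (Real.exp_pos _)
      _ = Real.exp (a * (n + 1)) := by rw [← Real.exp_add]; congr 1; ring
  exact absurd hviol (not_le.2 hchain)

end Q4Proof

/-- Q4 given P — S1 from Q3 by `BarkerPrange2020_thm1_slab_bounds` (i) (PROVED) + I1 (PROVED): **PROVED (v1.12)** by
`levelConcentration_of_slice_holds` (§11); the registered name is kept as a sorry-free alias. -/
theorem stub_levelConcentration_of_slice : LocalEnergySlice → QuietSliceSmallCube → LevelConcentration :=
  levelConcentration_of_slice_holds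

/-- Q4 — S1 from Q3 (v1.3 registered name), now DERIVED from P and Q4|P (no sorry of its own since v1.6). -/
theorem stub_levelConcentration_of_quietSlice : QuietSliceSmallCube → LevelConcentration :=
  stub_levelConcentration_of_slice stub_localEnergySlice

/-- **S1 `LevelConcentration` with the registered stubs plugged in (v1.2: no S2).** -/
theorem levelConcentration_of_stubs : LevelConcentration :=
  stub_levelConcentration_of_quietSlice stub_quietSliceSmallCube

/-- ★ **S1 `LevelConcentration` holds** (= `levelConcentration_of_stubs`: P `stub_localEnergySlice` and Q3 `stub_quietSliceSmallCube`
are tree theorems, so this is UNCONDITIONAL; typer's clean-named alias for the assembly). -/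
theorem levelConcentration_holds : LevelConcentration :=
  levelConcentration_of_stubs


end

end Summit.NavierStokesRegularity.NavierStokesRegularity.Cruxes.TypeIQuantSubcubicExp.FlatChain
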